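import Mathlib
import Literature.Computability.AlgebraicComplexity.SimultaneousDoubleProduct

/-!
# Shape packing for ordered escape ladders, by merging classes into one direct pair (support file)

Item `stmt-MatrixMultiplication-14308` (`FourierTwoFamiliesModP.PrimeTwoFamilies`, CKSU 2005
Conj. 4.7 with prime cyclic hosts), line Sketch, registered stub
`ladder_sum_card_mul_card_le_of_subshape` (siege k11, variation "reduce to landed lemmas, then
assemble").

A LADDER in an abelian group `G` is a family of `r` classes `(X c, Y c)`, `c : Fin r`, with

* (`hW`) every class direct: `(x - x') + (y - y') = 0` with `x, x' ∈ X c`, `y, y' ∈ Y c` forces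
  `x = x'` and `y = y'`;
* (`hL`) for classes `p < q` every lower cross difference `y' - x'` (`x' ∈ X p`, `y' ∈ Y q`) avoids
  every diagonal difference `y - x` (`x ∈ X c`, `y ∈ Y c`, any class `c`).

THE STUB: if a translate `u c +ᵥ Y₀` of ONE pattern `Y₀` sits inside `Y c` for every `c ∈ S`, then
`(Σ_{c ∈ S} |X c|) · |Y₀| ≤ |G|`.

THIS PROOF (reduction to the landed single-pair packing `card_mul_card_le_of_dpp`, CKSU Prop. 4.6,
the engine under `Theorems/PrimeTwoFamilies/Negative/Shapes.lean`): the whole configuration is ONE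
direct pair.  Precisely,

1. SEPARATION (`hL` at `(k, i, k)`): for `i < k` in `S`, `a ∈ X i`, `a' ∈ X k`, `b, b' ∈ Y₀`, the
   relation `(a - a') + (b - b') = 0` is impossible, because it says that the diagonal difference
   `(u_k + b) - a'` of class `k` equals the cross difference `(u_k + b') - a` between `X i` and `Y k`;
2. hence (taking `a = a'`, `b = b'`) the `X c`, `c ∈ S`, are pairwise disjoint as soon as `Y₀ ≠ ∅`,
   so `Σ_{c ∈ S} |X c| = |⋃_{c ∈ S} X c|`;
3. and the MERGED PAIR `(⋃_{c ∈ S} X c, Y₀)` has the double product property (W): across two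
   classes by separation (in either order), inside one class by directness `hW` of that class read
   on the translate `u_c +ᵥ Y₀ ⊆ Y c`;
4. so `|⋃_{c ∈ S} X c| · |Y₀| ≤ |G|` by the single-pair packing.

(The lead's file `FourierTwoFamiliesModPPrimeTwoFamiliesLadderShapes.lean` proves the same
statement by injectivity of `(c, x, y₀) ↦ x + y₀` on the sigma type; this is an independent second
proof under a separate namespace.)
-/

-- single-conjunct summit: the mandated namespace repeats `MatrixMultiplication` (summit = sub-problem).
set_option linter.dupNamespace false

namespace Summit.MatrixMultiplication.MatrixMultiplication.Theorems.PrimeTwoFamilies.LadderMergedPair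

open Finset
open scoped Pointwise
open Literature.Computability.AlgebraicComplexity

/-- **A common translated sub-pattern packs (ladders).**  If `(X c, Y c)_{c < r}` is a ladder
(`hW`: every class direct; `hL`: lower cross differences avoid all diagonal differences) and a
translate `u c +ᵥ Y₀` of one pattern `Y₀` lies inside `Y c` for every `c ∈ S`, then
`(Σ_{c ∈ S} |X c|) · |Y₀| ≤ |G|`.  Proof: the `X c` (`c ∈ S`) are pairwise disjoint and the merged
pair `(⋃_{c ∈ S} X c, Y₀)` is direct, so the single-pair packing `card_mul_card_le_of_dpp`
(CKSU 2005, Prop. 4.6) applies. -/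
theorem ladder_sum_card_mul_card_le_of_subshape {G : Type*} [AddCommGroup G] [Fintype G]
    [DecidableEq G] {r : ℕ} (X Y : Fin r → Finset G)
    (hW : ∀ c : Fin r, ∀ x ∈ X c, ∀ x' ∈ X c, ∀ y ∈ Y c, ∀ y' ∈ Y c,
      (x - x') + (y - y') = 0 → x = x' ∧ y = y')
    (hL : ∀ c p q : Fin r, p < q → ∀ x ∈ X c, ∀ y ∈ Y c, ∀ x' ∈ X p, ∀ y' ∈ Y q, y - x ≠ y' - x')
    (S : Finset (Fin r)) (Y₀ : Finset G) (u : Fin r → G) (hY : ∀ c ∈ S, u c +ᵥ Y₀ ⊆ Y c) :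
    (∑ c ∈ S, (X c).card) * Y₀.card ≤ Fintype.card G := by
  have memY : ∀ c ∈ S, ∀ b ∈ Y₀, u c + b ∈ Y c := fun c hc b hb =>
    hY c hc (Finset.mem_vadd_finset.2 ⟨b, hb, rfl⟩)
  -- (1) SEPARATION across classes `i < k` of `S` (from `hL` at `(k, i, k)`).
  have sep : ∀ i ∈ S, ∀ k ∈ S, i < k → ∀ a ∈ X i, ∀ a' ∈ X k, ∀ b ∈ Y₀, ∀ b' ∈ Y₀,
      (a - a') + (b - b') ≠ 0 := by
    intro i _ k hk hik a ha a' ha' b hb b' hb' h0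
    refine hL k i k hik a' ha' (u k + b) (memY k hk b hb) a ha (u k + b') (memY k hk b' hb') ?_
    have e : (u k + b) - a' - ((u k + b') - a) = (a - a') + (b - b') := by abel
    exact sub_eq_zero.1 (by rw [e, h0])
  -- If `Y₀ = ∅` there is nothing to prove.
  rcases Y₀.eq_empty_or_nonempty with hY0 | ⟨b₀, hb₀⟩
  · simp [hY0]
  -- (2) the `X c`, `c ∈ S`, are pairwise disjoint.
  have hdisj : (S : Set (Fin r)).PairwiseDisjoint X := by
    intro i hi k hk hik
    rcases lt_or_gt_of_ne hik with h | h
    · exact Finset.disjoint_left.2 fun a hai hak =>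
        sep i (Finset.mem_coe.1 hi) k (Finset.mem_coe.1 hk) h a hai a hak b₀ hb₀ b₀ hb₀
          (by rw [sub_self, sub_self, add_zero])
    · exact Finset.disjoint_right.2 fun a hak hai =>
        sep k (Finset.mem_coe.1 hk) i (Finset.mem_coe.1 hi) h a hak a hai b₀ hb₀ b₀ hb₀
          (by rw [sub_self, sub_self, add_zero])
  -- (3) the merged pair `(⋃_{c ∈ S} X c, Y₀)` has the double product property (W).
  have hW' : ∀ a ∈ S.biUnion X, ∀ a' ∈ S.biUnion X, ∀ b ∈ Y₀, ∀ b' ∈ Y₀,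
      (a - a') + (b - b') = 0 → a = a' ∧ b = b' := by
    intro a ha a' ha' b hb b' hb' h0
    rw [Finset.mem_biUnion] at ha ha'
    obtain ⟨i, hi, hai⟩ := ha
    obtain ⟨k, hk, hak⟩ := ha'
    rcases lt_trichotomy i k with hik | hik | hki
    · exact (sep i hi k hk hik a hai a' hak b hb b' hb' h0).elim
    · subst hik
      obtain ⟨h1, h2⟩ := hW i a hai a' hak (u i + b) (memY i hi b hb) (u i + b') (memY i hi b' hb')
        (by rw [add_sub_add_left_eq_sub]; exact h0)
      exact ⟨h1, add_left_cancel h2⟩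
    · have e : (a' - a) + (b' - b) = -((a - a') + (b - b')) := by abel
      exact (sep k hk i hi hki a' hak a hai b' hb' b hb (by rw [e, h0, neg_zero])).elim
  -- (4) assemble: additivity of `card` on the disjoint union + single-pair packing (CKSU Prop. 4.6).
  rw [← Finset.card_biUnion hdisj]
  exact card_mul_card_le_of_dpp hW'

end Summit.MatrixMultiplication.MatrixMultiplication.Theorems.PrimeTwoFamilies.LadderMergedPair
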